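import Summits.QuantumFields.YangMills.Theorems.CovariantDischargeLatticeFormsDeg23
import HarnessLib

/-!
# `UnitScaleGibbsCollarPairingZd` — THE COLLAR PAIRING ON `ℤ^d`: `(½·Σ σ·F)² ≤ 2·(Σ|δ₂σ|)·Σ|δ₂σ|·g² + ½·ε²·(Σ|σ|)²` WHEN `|F − d₁g| ≤ ε`
# (KNIT-B of the `stub_linTest` v3.1 plan; LINE 28 «GrossTransfer», crux `UnitScaleTilt.HistoryTailL` stmt-QuantumFields-19936 ∕ `MeanDeviationL` stmt-QuantumFields-23083)

Cell `ym3-torus` (YM ladder rung R3 = continuum SU(2) Yang–Mills on T³ — a RUNG, NOT the Clay problem: not d = 4, not infinite volume, not a mass gap),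
width seat `ym-ust-19936-w2` (gen 15), pen of record of `stub_linTest`.  The `ℤ^d` twin of ✓`UnitScaleGibbsCollarPairingSecondMoment` (torus, `cobd` via
`slotBond`), in the (Z-a) letters of ✓`CovariantDischargeLatticeFormsDeg23` that the KNIT uses through the chart of ✓`Prop7BoxChartTransport` (KNIT-PLAN,
23083 evidence #9, row P7): `σ` is the cutoff-commutator 2-form `E₁ − C₂` pulled back to `ℤ³`, `g(y,ν) = Re tr(τ_α((VU)⟨transl c y, ν⟩ − 1))` the dressed bond
letters, `F` the dressed curvature components with `|F − d₁g| ≤ 11η²` on the box (px5 ✓`abs_re_trace_plaq_sub_curl_le`).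
WHAT IS PROVED (generic `d`, pure finite-sum algebra, free symbols pinned by hypotheses, 0 `sorry`):
* `half_sum_mul_curl_eq_sum_deltaTwo_mul` — `½·Σ_{y∈Q_S}Σ_{μν} σ·(d₁g) = Σ_{y∈Q_S}Σ_ν (δ₂σ)(y,ν)·g(y,ν)` for antisymmetric `σ` vanishing off `Q_{S−1}`
  (✓`sum_mul_grad_eq_half_sum_mul_curl` + ✓`sum_deltaTwo_mul_of_support_left`);
* `abs_half_sum_mul_sub_le` — `|½ΣΣ σ·F − Σ (δ₂σ)·g| ≤ ½·ε·ΣΣ|σ|`;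
* `sq_sum_deltaTwo_mul_le` — weighted Cauchy–Schwarz `(Σ (δ₂σ)·g)² ≤ (Σ|δ₂σ|)·Σ|δ₂σ|·g²`;
* ★★`sq_half_sum_mul_le` — `(½ΣΣ σ·F)² ≤ 2·(Σ|δ₂σ|)·(Σ|δ₂σ|·g²) + ½·ε²·(ΣΣ|σ|)²`.
HONEST FRAMING.  Algebra; `--supports` helper; proves no stub, crux, rung or summit statement; `stub_linTest`, «ShallowFluxSecondMomentL», (Q), K1, `MeanDeviationL`,
`HistoryTailL` are NOT proved; the Yang–Mills mass gap is NOT proved.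
References: [GrossCMP1983] Thm 2.2 (the Schwinger–Dyson ∕ summation-by-parts bookkeeping); [Balaban1984PropagatorsII] (1.9) p. 226.
-/

noncomputable section

set_option autoImplicit false

open scoped BigOperators
open Finset

namespace Summit.QuantumFields.YangMills.Theorems.UnitScaleGibbsCollarPairingZd

open Literature.MathematicalPhysics.QuantumFieldTheory.Balaban1983to89.B4Eq19LatticeOperators
open Summit.QuantumFields.YangMills.Theorems.CovariantDischargeLatticeFormsDeg23 (sum_mul_grad_eq_half_sum_mul_curl sum_deltaTwo_mul_of_support_left)

variable {d : ℕ}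

/-- ★ `½·Σ_{y∈Q_S}Σ_{μν} σ(y,μ,ν)·(d₁g)(y,μ,ν) = Σ_{y∈Q_S}Σ_ν (δ₂σ)(y,ν)·g(y,ν)` for antisymmetric `σ` vanishing off `Q_{S−1}(z)`. [folklore] -/
theorem half_sum_mul_curl_eq_sum_deltaTwo_mul (σ : Zd d → Fin d → Fin d → ℝ) (g : Zd d → Fin d → ℝ) (dg : Zd d → Fin d → Fin d → ℝ)
    (δσ : Zd d → Fin d → ℝ) (z : Zd d) (S : ℤ)
    (hanti : ∀ x μ ν, σ x ν μ = -σ x μ ν) (hσ0 : ∀ y ∉ box z (S - 1), ∀ μ ν, σ y μ ν = 0)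
    (hdg : ∀ x μ ν, dg x μ ν = (g (x + unitVec μ) ν - g x ν) - (g (x + unitVec ν) μ - g x μ))
    (hδσ : ∀ y ν, δσ y ν = ∑ μ, (σ (y - unitVec μ) μ ν - σ y μ ν)) :
    (1 / 2) * ∑ y ∈ box z S, ∑ μ, ∑ ν, σ y μ ν * dg y μ ν = ∑ y ∈ box z S, ∑ ν, δσ y ν * g y ν := by
  have h1 : ∑ y ∈ box z S, ∑ μ, ∑ ν, σ y μ ν * (g (y + unitVec μ) ν - g y ν) = (1 / 2) * ∑ y ∈ box z S, ∑ μ, ∑ ν, σ y μ ν * dg y μ ν := by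
    rw [Finset.mul_sum]
    exact Finset.sum_congr rfl fun y _ => sum_mul_grad_eq_half_sum_mul_curl σ g dg hdg hanti y
  rw [← h1, ← sum_deltaTwo_mul_of_support_left σ g z S hσ0]
  exact Finset.sum_congr rfl fun y _ => Finset.sum_congr rfl fun ν _ => by rw [hδσ]

/-- `|½ΣΣ σ·F − Σ (δ₂σ)·g| ≤ ½·ε·ΣΣ|σ|` when `|F − d₁g| ≤ ε` on `Q_S(z)`. [folklore] -/
theorem abs_half_sum_mul_sub_le (σ F : Zd d → Fin d → Fin d → ℝ) (g : Zd d → Fin d → ℝ) (dg : Zd d → Fin d → Fin d → ℝ)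
    (δσ : Zd d → Fin d → ℝ) (z : Zd d) (S : ℤ) {ε : ℝ}
    (hanti : ∀ x μ ν, σ x ν μ = -σ x μ ν) (hσ0 : ∀ y ∉ box z (S - 1), ∀ μ ν, σ y μ ν = 0)
    (hdg : ∀ x μ ν, dg x μ ν = (g (x + unitVec μ) ν - g x ν) - (g (x + unitVec ν) μ - g x μ))
    (hδσ : ∀ y ν, δσ y ν = ∑ μ, (σ (y - unitVec μ) μ ν - σ y μ ν))
    (hF : ∀ y ∈ box z S, ∀ μ ν, |F y μ ν - dg y μ ν| ≤ ε) :
    |(1 / 2) * ∑ y ∈ box z S, ∑ μ, ∑ ν, σ y μ ν * F y μ ν - ∑ y ∈ box z S, ∑ ν, δσ y ν * g y ν|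
      ≤ (1 / 2) * ε * ∑ y ∈ box z S, ∑ μ, ∑ ν, |σ y μ ν| := by
  rw [← half_sum_mul_curl_eq_sum_deltaTwo_mul σ g dg δσ z S hanti hσ0 hdg hδσ, ← mul_sub, ← Finset.sum_sub_distrib, abs_mul,
    abs_of_pos (by norm_num : (0 : ℝ) < 1 / 2), mul_assoc]
  refine mul_le_mul_of_nonneg_left ?_ (by norm_num)
  rw [Finset.mul_sum]
  refine (Finset.abs_sum_le_sum_abs _ _).trans (Finset.sum_le_sum fun y hy => ?_)
  rw [← Finset.sum_sub_distrib, Finset.mul_sum]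
  refine (Finset.abs_sum_le_sum_abs _ _).trans (Finset.sum_le_sum fun μ _ => ?_)
  rw [← Finset.sum_sub_distrib, Finset.mul_sum]
  refine (Finset.abs_sum_le_sum_abs _ _).trans (Finset.sum_le_sum fun ν _ => ?_)
  rw [← mul_sub, abs_mul]
  calc |σ y μ ν| * |F y μ ν - dg y μ ν| ≤ |σ y μ ν| * ε := mul_le_mul_of_nonneg_left (hF y hy μ ν) (abs_nonneg _)
    _ = ε * |σ y μ ν| := mul_comm _ _

/-- Weighted Cauchy–Schwarz: `(Σ_yΣ_ν (δ₂σ)·g)² ≤ (Σ_yΣ_ν|δ₂σ|)·Σ_yΣ_ν|δ₂σ|·g²`. [folklore] -/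
theorem sq_sum_deltaTwo_mul_le (δσ g : Zd d → Fin d → ℝ) (B : Finset (Zd d)) :
    (∑ y ∈ B, ∑ ν, δσ y ν * g y ν) ^ 2 ≤ (∑ y ∈ B, ∑ ν, |δσ y ν|) * ∑ y ∈ B, ∑ ν, |δσ y ν| * g y ν ^ 2 := by
  rw [← Finset.sum_product' (f := fun y ν => δσ y ν * g y ν), ← Finset.sum_product' (f := fun y ν => |δσ y ν|),
    ← Finset.sum_product' (f := fun y ν => |δσ y ν| * g y ν ^ 2)]
  have hcs := Finset.sum_mul_sq_le_sq_mul_sq (B ×ˢ (Finset.univ : Finset (Fin d))) (fun q => Real.sqrt |δσ q.1 q.2|)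
    (fun q => Real.sqrt |δσ q.1 q.2| * (if 0 ≤ δσ q.1 q.2 then g q.1 q.2 else -g q.1 q.2))
  have e1 : ∀ q : Zd d × Fin d, Real.sqrt |δσ q.1 q.2| * (Real.sqrt |δσ q.1 q.2| * (if 0 ≤ δσ q.1 q.2 then g q.1 q.2 else -g q.1 q.2)) = δσ q.1 q.2 * g q.1 q.2 := by
    intro q
    rw [← mul_assoc, Real.mul_self_sqrt (abs_nonneg _)]
    split_ifs with h
    · rw [abs_of_nonneg h]
    · rw [abs_of_neg (lt_of_not_ge h)]; ring
  have e2 : ∀ q : Zd d × Fin d, Real.sqrt |δσ q.1 q.2| ^ 2 = |δσ q.1 q.2| := fun q => Real.sq_sqrt (abs_nonneg _)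
  have e3 : ∀ q : Zd d × Fin d, (Real.sqrt |δσ q.1 q.2| * (if 0 ≤ δσ q.1 q.2 then g q.1 q.2 else -g q.1 q.2)) ^ 2 = |δσ q.1 q.2| * g q.1 q.2 ^ 2 := by
    intro q
    rw [mul_pow, Real.sq_sqrt (abs_nonneg _)]
    split_ifs <;> ring
  simp only [e1, e2, e3] at hcs
  exact hcs

/-- ★★ **THE COLLAR PAIRING, SQUARED**: `(½ΣΣ σ·F)² ≤ 2·(Σ|δ₂σ|)·(Σ|δ₂σ|·g²) + ½·ε²·(ΣΣ|σ|)²`. [cite: GrossCMP1983, Thm 2.2] -/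
theorem sq_half_sum_mul_le (σ F : Zd d → Fin d → Fin d → ℝ) (g : Zd d → Fin d → ℝ) (dg : Zd d → Fin d → Fin d → ℝ)
    (δσ : Zd d → Fin d → ℝ) (z : Zd d) (S : ℤ) {ε : ℝ}
    (hanti : ∀ x μ ν, σ x ν μ = -σ x μ ν) (hσ0 : ∀ y ∉ box z (S - 1), ∀ μ ν, σ y μ ν = 0)
    (hdg : ∀ x μ ν, dg x μ ν = (g (x + unitVec μ) ν - g x ν) - (g (x + unitVec ν) μ - g x μ))
    (hδσ : ∀ y ν, δσ y ν = ∑ μ, (σ (y - unitVec μ) μ ν - σ y μ ν))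
    (hF : ∀ y ∈ box z S, ∀ μ ν, |F y μ ν - dg y μ ν| ≤ ε) :
    ((1 / 2) * ∑ y ∈ box z S, ∑ μ, ∑ ν, σ y μ ν * F y μ ν) ^ 2
      ≤ 2 * ((∑ y ∈ box z S, ∑ ν, |δσ y ν|) * ∑ y ∈ box z S, ∑ ν, |δσ y ν| * g y ν ^ 2)
        + (1 / 2) * (ε * ∑ y ∈ box z S, ∑ μ, ∑ ν, |σ y μ ν|) ^ 2 := by
  have h1 := abs_half_sum_mul_sub_le σ F g dg δσ z S hanti hσ0 hdg hδσ hF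
  have h2 := sq_sum_deltaTwo_mul_le δσ g (box z S)
  set X := (1 / 2) * ∑ y ∈ box z S, ∑ μ, ∑ ν, σ y μ ν * F y μ ν
  set Yv := ∑ y ∈ box z S, ∑ ν, δσ y ν * g y ν
  set D := (1 / 2) * ε * ∑ y ∈ box z S, ∑ μ, ∑ ν, |σ y μ ν| with hD
  have hX : X = Yv + (X - Yv) := by ring
  have hsq : X ^ 2 ≤ 2 * Yv ^ 2 + 2 * (X - Yv) ^ 2 := by nlinarith [sq_nonneg (Yv - (X - Yv))]
  have hd : (X - Yv) ^ 2 ≤ D ^ 2 := by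
    have h1' : |X - Yv| ≤ D := h1
    have hD0 : 0 ≤ D := (abs_nonneg _).trans h1'
    nlinarith [abs_nonneg (X - Yv), sq_abs (X - Yv), h1', hD0]
  have eD : 2 * D ^ 2 = (1 / 2) * (ε * ∑ y ∈ box z S, ∑ μ, ∑ ν, |σ y μ ν|) ^ 2 := by rw [hD]; ring
  nlinarith [hsq, hd, h2, eD]

end Summit.QuantumFields.YangMills.Theorems.UnitScaleGibbsCollarPairingZd

end
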